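import Literature.Analysis.FunctionSpaces.TorusKernelSmoothing
import Literature.Analysis.FunctionSpaces.TorusScalarTrigPoly
import Literature.Analysis.FunctionSpaces.TorusFourierConvolution
import HarnessLib

/-!
# Kernel smoothing on the flat torus, II: sup bounds, even-kernel approximation, scalar multipliers, band-limited scalars

Analysis/FunctionSpaces support file (all results proved; no definitions, no named facts),
continuing `TorusKernelSmoothing` (the `L^p` bound and the Fourier series of the **kernel
smoothing** `x ↦ ∫_{ℝ^d} K(z) • v(x - proj z) dz` of a torus field by an integrable kernel `K`
on `ℝ^d`; the expression is used literally, as there). It supplies the remaining elementary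
inputs of the Littlewood–Paley splitting `a = P_{≤κ/2}a + (a - P_{≤κ/2}a)` in the commutator
estimate of Buckmaster–Vicol (Ann. of Math. 189 (2019), App. B, Lemma B.1) and Luo–Titi
(Calc. Var. 59 (2020), Lemma 6), with the sharp projection replaced by a smooth low-pass kernel:

* `Torus.norm_integral_kernel_smul_le` — `‖∫ K(z) v(x - proj z) dz‖ ≤ ‖K‖_{L¹} sup ‖v‖`, and
  `Torus.continuous_integral_kernel_smul` (dominated convergence);
* `Literature.Analysis.FunctionSpaces.norm_second_difference_le` —
  `‖f(y+z) + f(y-z) - 2f(y)‖ ≤ A‖z‖²` for `‖D²f‖ ≤ A` (twice the mean value inequality), and the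
  **even-kernel approximation bound** `Torus.norm_sub_integral_kernel_smul_le_of_even`: for `K`
  even with `∫ K = 1` and a field whose lift has `‖D²(v ∘ proj)‖ ≤ A`,
  `‖v(x) - ∫ K(z) v(x - proj z) dz‖ ≤ (A/2) ∫ ‖z‖²|K(z)| dz` — the estimate
  "`‖a - P_{≤κ/2}a‖_{L^∞} ≲ κ⁻² ‖D²a‖_{L^∞}`" when `∫ ‖z‖²|K| ≲ κ⁻²`;
* `Torus.mFourierCoeff_ofReal_integral_kernel_smul` — on real scalars the smoothing is the
  Fourier multiplier `𝓕K|_{ℤ^d}`: `𝓕_T(∫ K(z) a(· - proj z) dz)(k) = 𝓕K(latticeVec k) â(k)`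
  (Fubini; the vector/smooth version is `Torus.hasSum_integral_kernel_smul`);
* `Torus.ofReal_eq_trigPoly_of_mFourierCoeff_eq_zero`, `Torus.isSmooth_of_mFourierCoeff_eq_zero` —
  a continuous real scalar whose Fourier coefficients vanish off a frequency ball is the real
  trigonometric polynomial `reTrigPoly (freqBall N) â` (`TorusScalarTrigPoly`), hence smooth
  (uniqueness of Fourier coefficients of continuous functions, `Torus.eq_of_forall_mFourierCoeff_eq`);
  so a low-pass smoothed scalar `P̃_{≤κ/2} a` is a smooth function with spectrum in `|k| < κ/2`.

## References

* L. Grafakos, *Classical Fourier Analysis*, 3rd ed. (2014), §3.1.1, Prop. 3.2.4 (uniqueness),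
  §4.3.2 (transference of convolution operators to the torus). [`Grafakos2014`]
* T. Buckmaster, V. Vicol, Ann. of Math. 189 (2019) = arXiv:1709.10033, App. B, proof of
  Lemma B.1. [`BuckmasterVicol2019AnnMath`]
-/

noncomputable section

open MeasureTheory Set Filter Function UnitAddTorus Complex
open scoped ENNReal NNReal ContDiff FourierTransform RealInnerProductSpace

namespace Literature.Analysis.FunctionSpaces

/-! ## Second differences of `C²` functions and approximation by even kernels (Euclidean) -/

section SecondDifference

variable {F : Type*} [NormedAddCommGroup F] [NormedSpace ℝ F]

/-- **Second differences of a `C²` function**: if `‖D²f‖ ≤ A` everywhere then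
`‖f(y + z) + f(y - z) - 2 f(y)‖ ≤ A ‖z‖²` (the mean value inequality applied to
`w ↦ f(w) - f(w - z)`, whose derivative `Df(w) - Df(w - z)` has norm `≤ A‖z‖` by the mean value
inequality for `Df`). [folklore] -/
theorem norm_second_difference_le {E : Type*} [NormedAddCommGroup E] [NormedSpace ℝ E]
    {f : E → F} (hf : ContDiff ℝ 2 f) {A : ℝ} (hA : ∀ y, ‖iteratedFDeriv ℝ 2 f y‖ ≤ A) (y z : E) :
    ‖f (y + z) + f (y - z) - (2 : ℝ) • f y‖ ≤ A * ‖z‖ ^ 2 := by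
  have hd : Differentiable ℝ f := hf.differentiable (by norm_num)
  have hd1 : Differentiable ℝ (fderiv ℝ f) :=
    (hf.fderiv_right (m := 1) (by norm_num)).differentiable (by norm_num)
  -- the first derivative is `A`-Lipschitz
  have hlip : ∀ w, ‖fderiv ℝ f w - fderiv ℝ f (w - z)‖ ≤ A * ‖z‖ := by
    intro w
    have h := Convex.norm_image_sub_le_of_norm_fderiv_le (f := fderiv ℝ f) (s := Set.univ) (C := A)
      (fun v _ => hd1.differentiableAt) (fun v _ => ?_) convex_univ (Set.mem_univ (w - z)) (Set.mem_univ w)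
    · simpa using h
    · rw [← norm_iteratedFDeriv_one, norm_iteratedFDeriv_fderiv]
      exact hA v
  -- the mean value inequality for `ψ(w) = f(w) - f(w - z)`
  set ψ : E → F := fun w => f w - f (w - z) with hψ
  have hψ' : ∀ w, HasFDerivAt ψ (fderiv ℝ f w - fderiv ℝ f (w - z)) w := by
    intro w
    have h2 := (hd (w - z)).hasFDerivAt.comp w ((hasFDerivAt_id w).sub_const z)
    rw [ContinuousLinearMap.comp_id] at h2
    exact (hd w).hasFDerivAt.sub h2
  have hmv := Convex.norm_image_sub_le_of_norm_fderiv_le (f := ψ) (s := Set.univ)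
    (fun w _ => (hψ' w).differentiableAt) (fun w _ => by rw [(hψ' w).fderiv]; exact hlip w) convex_univ
    (Set.mem_univ y) (Set.mem_univ (y + z))
  have hid : ψ (y + z) - ψ y = f (y + z) + f (y - z) - (2 : ℝ) • f y := by
    simp only [hψ, add_sub_cancel_right, two_smul]
    abel
  rw [← hid]
  calc ‖ψ (y + z) - ψ y‖ ≤ A * ‖z‖ * ‖y + z - y‖ := hmv
    _ = A * ‖z‖ ^ 2 := by rw [add_sub_cancel_left, pow_two, mul_assoc]

/-- Integrable times bounded continuous is integrable: `z ↦ K z • g z` on `ℝ^d`. [folklore] -/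
theorem integrable_smul_of_norm_le {d : Type*} [Fintype d]
    {K : EuclideanSpace ℝ d → ℝ} (hK : Integrable K volume) {g : EuclideanSpace ℝ d → F} (hg : Continuous g)
    {M : ℝ} (hM : ∀ z, ‖g z‖ ≤ M) : Integrable (fun z => K z • g z) volume :=
  (hK.norm.mul_const M).mono' (hK.aestronglyMeasurable.smul hg.aestronglyMeasurable)
    (Eventually.of_forall fun z => by
      rw [norm_smul]
      exact mul_le_mul_of_nonneg_left (hM z) (norm_nonneg _))

variable [CompleteSpace F]

/-- **Approximation by an even kernel of unit mass** (Euclidean form): for `K ∈ L¹(ℝ^d)` even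
with `∫ K = 1` and `∫ ‖z‖²|K| < ∞`, and a bounded `f ∈ C²` with `‖D²f‖ ≤ A`,
`‖f(y) - ∫ K(z) f(y - z) dz‖ ≤ (A/2) ∫ ‖z‖² |K(z)| dz`: by evenness
`2(f - K ∗ f) = -∫ K(z) (f(·+z) + f(·-z) - 2f) dz`. [folklore] -/
theorem norm_sub_integral_smul_le_of_even {d : Type*} [Fintype d] {f : EuclideanSpace ℝ d → F}
    (hf : ContDiff ℝ 2 f) {A : ℝ} (hA : ∀ y, ‖iteratedFDeriv ℝ 2 f y‖ ≤ A) {M₀ : ℝ} (hM₀ : ∀ y, ‖f y‖ ≤ M₀)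
    {K : EuclideanSpace ℝ d → ℝ} (hK : Integrable K volume) (hK1 : ∫ z, K z = 1)
    (hKe : ∀ z, K (-z) = K z) (hKm : Integrable (fun z => ‖z‖ ^ 2 * |K z|) volume)
    (y : EuclideanSpace ℝ d) :
    ‖f y - ∫ z, K z • f (y - z)‖ ≤ A / 2 * ∫ z, ‖z‖ ^ 2 * |K z| := by
  have i1 : Integrable (fun z => K z • f (y - z)) volume :=
    integrable_smul_of_norm_le hK (hf.continuous.comp (continuous_const.sub continuous_id)) fun z => hM₀ _
  have i2 : Integrable (fun z => K z • f (y + z)) volume :=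
    integrable_smul_of_norm_le hK (hf.continuous.comp (continuous_const.add continuous_id)) fun z => hM₀ _
  have i3 : Integrable (fun z => K z • f y) volume := hK.smul_const _
  have heven : ∫ z, K z • f (y - z) = ∫ z, K z • f (y + z) := by
    rw [← integral_neg_eq_self (fun z => K z • f (y + z)) volume]
    refine integral_congr_ae (Eventually.of_forall fun z => ?_)
    simp only [hKe, ← sub_eq_add_neg]
  have hconst : ∫ z, K z • f y = f y := by rw [integral_smul_const, hK1, one_smul]
  have h2 : (2 : ℝ) • (f y - ∫ z, K z • f (y - z)) =
      -∫ z, K z • (f (y + z) + f (y - z) - (2 : ℝ) • f y) := by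
    have i12 : Integrable (fun z => K z • f (y + z) + K z • f (y - z)) volume := i2.add i1
    have i33 : Integrable (fun z => (2 : ℝ) • (K z • f y)) volume := i3.smul 2
    have hsplit : ∫ z, K z • (f (y + z) + f (y - z) - (2 : ℝ) • f y) =
        (∫ z, K z • f (y + z)) + (∫ z, K z • f (y - z)) - (2 : ℝ) • ∫ z, K z • f y := by
      rw [← integral_add i2 i1, ← integral_smul, ← integral_sub i12 i33]
      refine integral_congr_ae (Eventually.of_forall fun z => ?_)
      dsimp only
      rw [smul_sub, smul_add, smul_comm (K z) (2 : ℝ) (f y)]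
    rw [hsplit, heven, hconst, two_smul, two_smul]
    abel
  have h3 : ‖(2 : ℝ) • (f y - ∫ z, K z • f (y - z))‖ ≤ A * ∫ z, ‖z‖ ^ 2 * |K z| := by
    rw [h2, norm_neg]
    calc ‖∫ z, K z • (f (y + z) + f (y - z) - (2 : ℝ) • f y)‖
        ≤ ∫ z, ‖K z • (f (y + z) + f (y - z) - (2 : ℝ) • f y)‖ := norm_integral_le_integral_norm _
      _ ≤ ∫ z, A * (‖z‖ ^ 2 * |K z|) := by
          refine integral_mono_of_nonneg (Eventually.of_forall fun z => norm_nonneg _) (hKm.const_mul A)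
            (Eventually.of_forall fun z => ?_)
          dsimp only
          rw [norm_smul, Real.norm_eq_abs]
          calc |K z| * ‖f (y + z) + f (y - z) - (2 : ℝ) • f y‖ ≤ |K z| * (A * ‖z‖ ^ 2) :=
                mul_le_mul_of_nonneg_left (norm_second_difference_le hf hA y z) (abs_nonneg _)
            _ = A * (‖z‖ ^ 2 * |K z|) := by ring
      _ = A * ∫ z, ‖z‖ ^ 2 * |K z| := integral_const_mul _ _
  rw [norm_smul, Real.norm_of_nonneg zero_le_two] at h3
  have : A / 2 * ∫ z, ‖z‖ ^ 2 * |K z| = (A * ∫ z, ‖z‖ ^ 2 * |K z|) / 2 := by ring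
  rw [this]
  linarith

end SecondDifference

namespace Torus

variable {d : Type*} [Fintype d]

/-! ## Size and continuity of the kernel smoothing -/

section Basic

variable {F : Type*} [NormedAddCommGroup F] [NormedSpace ℝ F]

/-- **Sup bound** `‖∫ K(z) v(x - proj z) dz‖ ≤ ‖K‖_{L¹} sup ‖v‖`. [folklore] -/
theorem norm_integral_kernel_smul_le {K : EuclideanSpace ℝ d → ℝ} (hK : Integrable K volume)
    {v : UnitAddTorus d → F} {M : ℝ} (hM : ∀ y, ‖v y‖ ≤ M) (x : UnitAddTorus d) :
    ‖∫ z : EuclideanSpace ℝ d, K z • v (x - proj z)‖ ≤ (∫ z, |K z|) * M := by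
  calc ‖∫ z : EuclideanSpace ℝ d, K z • v (x - proj z)‖
      ≤ ∫ z : EuclideanSpace ℝ d, ‖K z • v (x - proj z)‖ := norm_integral_le_integral_norm _
    _ ≤ ∫ z, |K z| * M := by
        refine integral_mono_of_nonneg (Eventually.of_forall fun z => norm_nonneg _) (hK.abs.mul_const M)
          (Eventually.of_forall fun z => ?_)
        dsimp only
        rw [norm_smul, Real.norm_eq_abs]
        exact mul_le_mul_of_nonneg_left (hM _) (abs_nonneg _)
    _ = (∫ z, |K z|) * M := integral_mul_const _ _

/-- **Continuity of the kernel smoothing** of a continuous field by an integrable kernel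
(dominated convergence, majorant `|K(z)| sup‖v‖`). [folklore] -/
theorem continuous_integral_kernel_smul {K : EuclideanSpace ℝ d → ℝ} (hK : Integrable K volume)
    {v : UnitAddTorus d → F} (hv : Continuous v) :
    Continuous fun x : UnitAddTorus d => ∫ z : EuclideanSpace ℝ d, K z • v (x - proj z) := by
  obtain ⟨M, hM⟩ := exists_forall_norm_le_of_continuous hv
  refine continuous_of_dominated (bound := fun z => ‖K z‖ * M) (fun x => ?_) (fun x => ?_)
    (hK.norm.mul_const M) (Eventually.of_forall fun z => ?_)
  · exact hK.aestronglyMeasurable.smul (hv.comp (continuous_const.sub continuous_proj)).aestronglyMeasurable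
  · refine Eventually.of_forall fun z => ?_
    rw [norm_smul]
    exact mul_le_mul_of_nonneg_left (hM _) (norm_nonneg _)
  · exact (hv.comp (continuous_id.sub continuous_const)).const_smul _

/-- **Approximation by an even kernel of unit mass** (torus form): for `K ∈ L¹(ℝ^d)` even with
`∫ K = 1`, `∫ ‖z‖²|K| < ∞`, and `v : T^d → F` with `C²` lift, `‖D²(v ∘ proj)‖ ≤ A`,
`‖v(x) - ∫ K(z) v(x - proj z) dz‖ ≤ (A/2) ∫ ‖z‖² |K(z)| dz` — the estimate
"`‖a - P_{≤κ/2} a‖_{L^∞} ≲ κ⁻² ‖D²a‖_{L^∞}`" when `K` is a low-pass kernel at scale `κ`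
(`∫ ‖z‖²|K| ≲ κ⁻²`; Buckmaster–Vicol 2019, App. B). [folklore] -/
theorem norm_sub_integral_kernel_smul_le_of_even [CompleteSpace F] {v : UnitAddTorus d → F}
    (hv : IsContDiff 2 v) {A : ℝ} (hA : ∀ y, ‖iteratedFDeriv ℝ 2 (lift v) y‖ ≤ A)
    {K : EuclideanSpace ℝ d → ℝ} (hK : Integrable K volume) (hK1 : ∫ z, K z = 1)
    (hKe : ∀ z, K (-z) = K z) (hKm : Integrable (fun z => ‖z‖ ^ 2 * |K z|) volume)
    (x : UnitAddTorus d) :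
    ‖v x - ∫ z : EuclideanSpace ℝ d, K z • v (x - proj z)‖ ≤ A / 2 * ∫ z, ‖z‖ ^ 2 * |K z| := by
  obtain ⟨M₀, hM₀⟩ := exists_forall_norm_le_of_continuous hv.continuous
  have hM₀' : ∀ y, ‖lift v y‖ ≤ M₀ := fun y => hM₀ _
  have h := norm_sub_integral_smul_le_of_even (f := lift v) hv hA hM₀' hK hK1 hKe hKm (repr x)
  have hid : ∀ z, lift v (repr x - z) = v (x - proj z) := by
    intro z
    rw [lift_apply, proj_sub, proj_repr]
  simp_rw [hid, lift_repr] at h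
  exact h

end Basic

/-! ## Scalar multiplier identity and band-limited scalars -/

section Scalar

variable [DecidableEq d]

omit [DecidableEq d] in
/-- Translation of a Fourier coefficient: `∫ e_{-k}(x) g(x - proj z) dx = e_{-k}(proj z) 𝓕g(k)`.
[folklore] -/
theorem integral_mFourier_neg_mul_comp_sub_proj (g : UnitAddTorus d → ℂ) (k : d → ℤ)
    (z : EuclideanSpace ℝ d) :
    ∫ x, mFourier (-k) x * g (x - proj z) = mFourier (-k) (proj z) * mFourierCoeff g k := by
  have h := integral_sub_right_eq_self (μ := (volume : Measure (UnitAddTorus d)))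
    (fun y => mFourier (-k) (y + proj z) * g y) (proj z)
  simp only [sub_add_cancel] at h
  rw [h, mFourierCoeff_eq_integral_volume, ← integral_const_mul]
  refine integral_congr_ae (Eventually.of_forall fun y => ?_)
  dsimp only
  rw [mFourier_apply_add, smul_eq_mul]
  ring

/-- `⟪z, latticeVec (-k)⟫ = -⟪z, latticeVec k⟫`. [folklore] -/
theorem inner_latticeVec_neg_right (z : EuclideanSpace ℝ d) (k : d → ℤ) :
    ⟪z, latticeVec (-k)⟫ = -⟪z, latticeVec k⟫ := by
  rw [inner_latticeVec_right, inner_latticeVec_right, ← Finset.sum_neg_distrib]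
  refine Finset.sum_congr rfl fun i _ => ?_
  simp only [Pi.neg_apply, Int.cast_neg, mul_neg]

/-- `e_{-k}(proj z) = 𝐞(-⟨z, latticeVec k⟩)`. [folklore] -/
theorem mFourier_neg_proj (k : d → ℤ) (z : EuclideanSpace ℝ d) :
    mFourier (-k) (proj z) = (𝐞 (-⟪z, latticeVec k⟫) : ℂ) := by
  rw [mFourier_proj_eq_fourierChar, inner_latticeVec_neg_right]

/-- **The kernel smoothing is the Fourier multiplier `𝓕K|_{ℤ^d}` on real scalars**: for
`K ∈ L¹(ℝ^d)` and continuous `a : T^d → ℝ`,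
`𝓕_T(∫ K(z) a(· - proj z) dz)(k) = 𝓕K(latticeVec k) · 𝓕_T a(k)` (Fubini over `T^d × ℝ^d` and
translation invariance; Grafakos 2014, §4.3.2). [folklore] -/
theorem mFourierCoeff_ofReal_integral_kernel_smul {K : EuclideanSpace ℝ d → ℝ} (hK : Integrable K volume)
    {a : UnitAddTorus d → ℝ} (ha : Continuous a) (k : d → ℤ) :
    mFourierCoeff (fun x => ((∫ z : EuclideanSpace ℝ d, K z • a (x - proj z) : ℝ) : ℂ)) k =
      𝓕 (fun z : EuclideanSpace ℝ d => (K z : ℂ)) (latticeVec k) * mFourierCoeff (fun x => (a x : ℂ)) k := by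
  obtain ⟨M, hM⟩ := exists_forall_norm_le_of_continuous ha
  -- the jointly integrable function on `T^d × ℝ^d`
  set Φ : UnitAddTorus d → EuclideanSpace ℝ d → ℂ := fun x z =>
    mFourier (-k) x * ((K z : ℂ) * (a (x - proj z) : ℂ)) with hΦ
  have hint : Integrable (uncurry Φ) ((volume : Measure (UnitAddTorus d)).prod volume) := by
    have hK2 : Integrable (fun p : UnitAddTorus d × EuclideanSpace ℝ d => (K p.2 : ℂ))
        ((volume : Measure (UnitAddTorus d)).prod volume) :=
      Integrable.comp_snd (f := fun z : EuclideanSpace ℝ d => ((K z : ℝ) : ℂ)) hK.ofReal volume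
    refine (hK2.norm.mul_const M).mono' ?_ (Eventually.of_forall fun p => ?_)
    · exact ((mFourier (-k)).continuous.comp continuous_fst).aestronglyMeasurable.mul
        (hK2.aestronglyMeasurable.mul (Complex.continuous_ofReal.comp
          (ha.comp (continuous_fst.sub (continuous_proj.comp continuous_snd)))).aestronglyMeasurable)
    · simp only [uncurry, hΦ, norm_mul]
      have he : ‖mFourier (-k) p.1‖ ≤ 1 := ((mFourier (-k)).norm_coe_le_norm p.1).trans_eq mFourier_norm
      have ha' : ‖(a (p.1 - proj p.2) : ℂ)‖ ≤ M := by rw [Complex.norm_real]; exact hM _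
      calc ‖mFourier (-k) p.1‖ * (‖(K p.2 : ℂ)‖ * ‖(a (p.1 - proj p.2) : ℂ)‖)
          ≤ 1 * (‖(K p.2 : ℂ)‖ * M) :=
            mul_le_mul he (mul_le_mul_of_nonneg_left ha' (norm_nonneg _)) (by positivity) zero_le_one
        _ = ‖(K p.2 : ℂ)‖ * M := one_mul _
  calc mFourierCoeff (fun x => ((∫ z : EuclideanSpace ℝ d, K z • a (x - proj z) : ℝ) : ℂ)) k
      = ∫ x, ∫ z, Φ x z := by
        rw [mFourierCoeff_eq_integral_volume]
        refine integral_congr_ae (Eventually.of_forall fun x => ?_)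
        simp only [hΦ, smul_eq_mul]
        rw [← integral_complex_ofReal, ← integral_const_mul]
        refine integral_congr_ae (Eventually.of_forall fun z => ?_)
        push_cast
        ring
    _ = ∫ z, ∫ x, Φ x z := integral_integral_swap hint
    _ = ∫ z, (K z : ℂ) * mFourier (-k) (proj z) * mFourierCoeff (fun x => (a x : ℂ)) k := by
        refine integral_congr_ae (Eventually.of_forall fun z => ?_)
        simp only [hΦ]
        have h1 : ∀ x, mFourier (-k) x * ((K z : ℂ) * (a (x - proj z) : ℂ)) =
            (K z : ℂ) * (mFourier (-k) x * (a (x - proj z) : ℂ)) := fun x => by ring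
        simp_rw [h1]
        rw [integral_const_mul, integral_mFourier_neg_mul_comp_sub_proj (fun x => (a x : ℂ)) k z, mul_assoc]
    _ = (∫ z, (K z : ℂ) * mFourier (-k) (proj z)) * mFourierCoeff (fun x => (a x : ℂ)) k :=
        integral_mul_const _ _
    _ = 𝓕 (fun z => (K z : ℂ)) (latticeVec k) * mFourierCoeff (fun x => (a x : ℂ)) k := by
        congr 1
        rw [Real.fourier_eq]
        refine integral_congr_ae (Eventually.of_forall fun z => ?_)
        dsimp only
        rw [mFourier_neg_proj, Circle.smul_def, smul_eq_mul, mul_comm]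

/-- **A band-limited continuous real scalar is a trigonometric polynomial**: if the Fourier
coefficients of the continuous real `θ` vanish off the frequency ball `freqBall N`, then
`(θ x : ℂ) = trigPoly (freqBall N) θ̂ x` (uniqueness of Fourier coefficients of continuous
functions, Grafakos 2014, Prop. 3.2.4). [folklore] -/
theorem ofReal_eq_trigPoly_of_mFourierCoeff_eq_zero {θ : UnitAddTorus d → ℝ} (hθ : Continuous θ)
    {N : ℕ} (h : ∀ k, k ∉ freqBall N → mFourierCoeff (fun x => (θ x : ℂ)) k = 0) :
    (fun x => (θ x : ℂ)) = trigPoly (freqBall N) (fun k => mFourierCoeff (fun x => (θ x : ℂ)) k) := by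
  classical
  refine eq_of_forall_mFourierCoeff_eq (Complex.continuous_ofReal.comp hθ) (continuous_trigPoly _ _)
    fun k => ?_
  rw [mFourierCoeff_trigPoly]
  by_cases hk : k ∈ freqBall N
  · rw [if_pos hk]
  · rw [if_neg hk, h k hk]

/-- The same in real form: `θ = reTrigPoly (freqBall N) θ̂`. [folklore] -/
theorem eq_reTrigPoly_of_mFourierCoeff_eq_zero {θ : UnitAddTorus d → ℝ} (hθ : Continuous θ)
    {N : ℕ} (h : ∀ k, k ∉ freqBall N → mFourierCoeff (fun x => (θ x : ℂ)) k = 0) :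
    θ = reTrigPoly (freqBall N) (fun k => mFourierCoeff (fun x => (θ x : ℂ)) k) := by
  funext x
  have hx := congr_fun (ofReal_eq_trigPoly_of_mFourierCoeff_eq_zero hθ h) x
  have hre := congrArg Complex.re hx
  simpa [reTrigPoly] using hre

/-- **A band-limited continuous real scalar is smooth** (it is the real trigonometric polynomial
`reTrigPoly (freqBall N) θ̂`). [folklore] -/
theorem isSmooth_of_mFourierCoeff_eq_zero {θ : UnitAddTorus d → ℝ} (hθ : Continuous θ)
    {N : ℕ} (h : ∀ k, k ∉ freqBall N → mFourierCoeff (fun x => (θ x : ℂ)) k = 0) : IsSmooth θ := by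
  rw [eq_reTrigPoly_of_mFourierCoeff_eq_zero hθ h]
  exact isSmooth_reTrigPoly _ _

end Scalar

end Torus

end Literature.Analysis.FunctionSpaces
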